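import Mathlib.NumberTheory.Chebyshev
import Mathlib.Algebra.Order.Field.GeomSum
import Literature.NumberTheory.LFunctions.PrimeSumInvSqrt
import Literature.NumberTheory.LFunctions.MertensElementary
import HarnessLib

/-!
# Chebyshev-type bounds for `Σ_{n ≤ u} Λ(n)/(√n log n)` and its logarithmic weighting

Topic `Literature/NumberTheory/LFunctions`. Everything in this file is PROVED (no definitions, no
named facts).

The elementary estimates behind condition (i) of Soundararajan's "`V`-typical ordinates" as used
by M. Balazard–A. de Roton, arXiv:0810.3587, proof of Prop. 18 (and arXiv:0812.1689, proof of
Prop. 9): with `f(u) = Σ_{n ≤ u} Λ(n)/(√n log n)`,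

* `f(u) ≤ 60 √u/log u + (7/2)(log log u + 4)` for `u ≥ 2`
  (`Literature.NumberTheory.LFunctions.vonMangoldt_div_sqrt_log_sum_le`; primes by
  `sum_primes_inv_sqrt_le`, proper prime powers by Mertens);
* `Σ_{n ≤ x} Λ(n)/(√n log n) · log(x/n) = ∫_2^x f(u) du/u ≤ 1320 √x/log x + (7/2)(log log x + 4) log x`
  for `x ≥ 2` (`Literature.NumberTheory.LFunctions.vonMangoldt_weighted_sum_le`, Abel summation).

Also the elementary facts on proper prime powers (`ChebyshevWeighted.sum_properPrimePow_inv_sqrt_le`: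
`Σ_{n ≤ X, n = p^k, k ≥ 2} n^{-1/2} ≤ (7/2) Σ_{p ≤ X} 1/p`) and
`∫_2^X t^{-1/2}/log t dt ≤ 22 √X/log X` (`ChebyshevWeighted.integral_rpow_neg_half_div_log_le`).

## References

* [BalazardDeRoton2008] M. Balazard, A. de Roton, arXiv:0810.3587, Prop. 18 (proof of (i)).
  [cite: BalazardDeRoton2008, Prop. 18 (proof)]
* [HardyWright2008] G. H. Hardy, E. M. Wright, 6th ed., Thms. 7, 414, 427.
-/

noncomputable section

open Real Filter Set MeasureTheory intervalIntegral Finset ArithmeticFunction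

namespace Literature.NumberTheory.LFunctions

namespace ChebyshevWeighted

open ChebyshevInvSqrt

/-! ## Proper prime powers -/

/-- `Σ_{k ∈ [2, N)} r^k ≤ (7/2) r²` for `0 ≤ r ≤ 1/√2`. [folklore] -/
lemma geom_tail_le {r : ℝ} (hr0 : 0 ≤ r) (hr : r ≤ 1 / Real.sqrt 2) (N : ℕ) :
    ∑ k ∈ Finset.Ico 2 N, r ^ k ≤ (7 / 2) * r ^ 2 := by
  have hs2' : (7 / 5 : ℝ) < Real.sqrt 2 := by
    rw [Real.lt_sqrt (by norm_num)]; norm_num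
  have hr57 : r ≤ 5 / 7 := by
    refine hr.trans ?_
    rw [div_le_div_iff₀ (by positivity) (by norm_num)]
    nlinarith
  have hr1 : r < 1 := by linarith
  refine (geom_sum_Ico_le_of_lt_one hr0 hr1).trans ?_
  rw [div_le_iff₀ (by linarith)]
  nlinarith [sq_nonneg r]

/-- A proper prime power is not prime. [folklore] -/
lemma not_prime_pow {p k : ℕ} (hp : p.Prime) (hk : 2 ≤ k) : ¬ (p ^ k).Prime := by
  intro h
  have hd : p ∣ p ^ k := dvd_pow_self p (by omega)
  rcases h.eq_one_or_self_of_dvd p hd with h1 | h1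
  · exact hp.one_lt.ne' h1
  · have : p < p ^ k := lt_self_pow₀ hp.one_lt (by omega)
    omega

/-- **The proper prime powers are rare**: for `X ≥ 2`,
`Σ_{n ≤ X, n = p^k, k ≥ 2} 1/√n ≤ (7/2) Σ_{p ≤ X} 1/p`. [folklore] -/
theorem sum_properPrimePow_inv_sqrt_le {X : ℝ} (hX : 2 ≤ X) :
    ∑ n ∈ (Finset.Ioc 0 ⌊X⌋₊).filter (fun n ↦ IsPrimePow n ∧ ¬ n.Prime), (1 / Real.sqrt n : ℝ) ≤
      (7 / 2) * ∑ p ∈ (Finset.Ioc 0 ⌊X⌋₊).filter Nat.Prime, (1 / p : ℝ) := by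
  have hX0 : 0 ≤ X := by linarith
  set f : ℕ → ℝ := fun n ↦ if n.Prime then 0 else 1 / Real.sqrt n with hf
  have h1 : ∑ n ∈ (Finset.Ioc 0 ⌊X⌋₊).filter (fun n ↦ IsPrimePow n ∧ ¬ n.Prime), (1 / Real.sqrt n : ℝ) =
      ∑ n ∈ (Finset.Ioc 0 ⌊X⌋₊).filter IsPrimePow, f n := by
    rw [Finset.sum_filter, Finset.sum_filter]
    refine Finset.sum_congr rfl fun n _ ↦ ?_
    by_cases hp : n.Prime <;> by_cases hpp : IsPrimePow n <;> simp [hf, hp, hpp]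
  rw [h1, Chebyshev.sum_PrimePow_eq_sum_sum f hX0]
  set P := (Finset.Ioc 0 ⌊X⌋₊).filter Nat.Prime with hP
  set K := ⌊Real.log X / Real.log 2⌋₊ with hK
  have hinner : ∀ k ∈ Finset.Icc 1 K,
      ∑ p ∈ (Finset.Ioc 0 ⌊X ^ ((1 : ℝ) / k)⌋₊).filter Nat.Prime, f (p ^ k) ≤
        ∑ p ∈ P, (if k = 1 then 0 else ((1 / Real.sqrt p) ^ k : ℝ)) := by
    intro k hk
    rw [Finset.mem_Icc] at hk
    have hsub : (Finset.Ioc 0 ⌊X ^ ((1 : ℝ) / k)⌋₊).filter Nat.Prime ⊆ P := by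
      intro p hp
      rw [Finset.mem_filter, Finset.mem_Ioc] at hp ⊢
      refine ⟨⟨hp.1.1, hp.1.2.trans (Nat.floor_le_floor ?_)⟩, hp.2⟩
      refine Real.rpow_le_self_of_one_le (by linarith) ?_
      rw [div_le_one (by exact_mod_cast hk.1)]; exact_mod_cast hk.1
    have hterm : ∀ p ∈ P, f (p ^ k) = if k = 1 then 0 else ((1 / Real.sqrt p) ^ k : ℝ) := by
      intro p hp
      rw [hP, Finset.mem_filter] at hp
      rcases eq_or_ne k 1 with rfl | hk1
      · simp [hf, hp.2]
      · have hk2 : 2 ≤ k := by omega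
        rw [if_neg hk1]
        simp only [hf, if_neg (not_prime_pow hp.2 hk2)]
        push_cast
        have hsq : Real.sqrt ((p : ℝ) ^ k) = Real.sqrt p ^ k := by
          rw [Real.sqrt_eq_iff_mul_self_eq (pow_nonneg (by positivity) k) (pow_nonneg (Real.sqrt_nonneg _) k),
            ← pow_two, ← pow_mul, mul_comm, pow_mul, Real.sq_sqrt (by positivity)]
        rw [hsq, div_pow, one_pow]
    calc ∑ p ∈ (Finset.Ioc 0 ⌊X ^ ((1 : ℝ) / k)⌋₊).filter Nat.Prime, f (p ^ k)
        ≤ ∑ p ∈ P, f (p ^ k) := Finset.sum_le_sum_of_subset_of_nonneg hsub fun p _ _ ↦ by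
          simp only [hf]; split_ifs <;> positivity
      _ = ∑ p ∈ P, (if k = 1 then 0 else ((1 / Real.sqrt p) ^ k : ℝ)) := Finset.sum_congr rfl hterm
  refine (Finset.sum_le_sum hinner).trans ?_
  rw [Finset.sum_comm, Finset.mul_sum]
  refine Finset.sum_le_sum fun p hp ↦ ?_
  rw [hP, Finset.mem_filter] at hp
  have hp2 : (2 : ℝ) ≤ p := by exact_mod_cast hp.2.two_le
  set r : ℝ := 1 / Real.sqrt p with hr
  have hr0 : 0 ≤ r := by positivity
  have hrle : r ≤ 1 / Real.sqrt 2 := by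
    rw [hr]; gcongr
  have hr2 : r ^ 2 = 1 / p := by
    rw [hr, div_pow, one_pow, Real.sq_sqrt (by positivity)]
  have hfilt : ∑ k ∈ Finset.Icc 1 K, (if k = 1 then 0 else r ^ k) = ∑ k ∈ (Finset.Icc 1 K).filter (· ≠ 1), r ^ k := by
    rw [Finset.sum_filter]
    refine Finset.sum_congr rfl fun k _ ↦ ?_
    by_cases hk : k = 1 <;> simp [hk]
  have hsub : (Finset.Icc 1 K).filter (· ≠ 1) ⊆ Finset.Ico 2 (K + 1) := by
    intro k hk
    rw [Finset.mem_filter, Finset.mem_Icc] at hk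
    rw [Finset.mem_Ico]; omega
  calc ∑ k ∈ Finset.Icc 1 K, (if k = 1 then 0 else r ^ k)
      = ∑ k ∈ (Finset.Icc 1 K).filter (· ≠ 1), r ^ k := hfilt
    _ ≤ ∑ k ∈ Finset.Ico 2 (K + 1), r ^ k :=
        Finset.sum_le_sum_of_subset_of_nonneg hsub fun k _ _ ↦ by positivity
    _ ≤ (7 / 2) * r ^ 2 := geom_tail_le hr0 hrle _
    _ = (7 / 2) * (1 / p) := by rw [hr2]


/-- Mertens on a real range: `Σ_{p ≤ u} 1/p ≤ log log u + 4` for `u ≥ 2`.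
[cite: HardyWright2008, Thm 427] -/
theorem sum_inv_prime_real_le {u : ℝ} (hu : 2 ≤ u) :
    ∑ p ∈ (Finset.Ioc 0 ⌊u⌋₊).filter Nat.Prime, (1 / p : ℝ) ≤ Real.log (Real.log u) + 4 := by
  set N : ℕ := ⌊u⌋₊ with hN
  have hN2 : 2 ≤ N := Nat.le_floor (by exact_mod_cast hu)
  have hset : (Finset.Ioc 0 N).filter Nat.Prime = Nat.primesLE N := by
    ext p
    simp only [Finset.mem_filter, Finset.mem_Ioc, Nat.mem_primesLE]
    constructor
    · rintro ⟨⟨_, h2⟩, h3⟩; exact ⟨h2, h3⟩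
    · rintro ⟨h2, h3⟩; exact ⟨⟨h3.pos, h2⟩, h3⟩
  rw [hset]
  refine (MertensBound.sum_inv_prime_le N hN2).trans ?_
  have hNpos : (0 : ℝ) < N := by exact_mod_cast (by omega : 0 < N)
  have hN2r : (2 : ℝ) ≤ N := by exact_mod_cast hN2
  have hNle : (N : ℝ) ≤ u := Nat.floor_le (by linarith)
  have hlogN : 0 < Real.log N := Real.log_pos (by linarith)
  gcongr

/-! ## The integral `∫_2^X t^{-1/2}/log t dt` -/

/-- `∫_2^X t^{-1/2}/log t dt ≤ 22 √X / log X` for `X ≥ 2`. [folklore] -/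
theorem integral_rpow_neg_half_div_log_le {X : ℝ} (hX : 2 ≤ X) :
    ∫ t in (2 : ℝ)..X, t ^ (-(1 / 2) : ℝ) / Real.log t ≤ 22 * Real.sqrt X / Real.log X := by
  have hX0 : 0 < X := by linarith
  have hX1 : 1 < X := by linarith
  have hlogX : 0 < Real.log X := Real.log_pos hX1
  have hsX : 0 < Real.sqrt X := Real.sqrt_pos.2 hX0
  set Y : ℝ := max 2 (Real.sqrt X) with hY
  have hY2 : 2 ≤ Y := le_max_left _ _
  have hYX : Y ≤ X := max_le hX (by
    rw [Real.sqrt_le_left hX0.le]; nlinarith)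
  have hg_int : ∀ a b : ℝ, 2 ≤ a → a ≤ b → IntervalIntegrable (fun t : ℝ ↦ t ^ (-(1 / 2) : ℝ) / Real.log t) volume a b := by
    intro a b ha hab
    refine ContinuousOn.intervalIntegrable ?_
    rw [Set.uIcc_of_le hab]
    refine ContinuousOn.div ?_ ?_ ?_
    · exact ContinuousOn.rpow_const continuousOn_id fun t ht ↦ Or.inl (ne_of_gt (show (0 : ℝ) < t by linarith [ht.1]))
    · exact Real.continuousOn_log.mono fun t ht ↦ by simp only [Set.mem_compl_iff, Set.mem_singleton_iff]; linarith [ht.1]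
    · intro t ht; exact (Real.log_pos (by linarith [ht.1])).ne'
  have hpow_int : ∀ a b : ℝ, 0 < a → a ≤ b → IntervalIntegrable (fun t : ℝ ↦ t ^ (-(1 / 2) : ℝ)) volume a b := by
    intro a b ha hab
    refine ContinuousOn.intervalIntegrable ?_
    rw [Set.uIcc_of_le hab]
    exact ContinuousOn.rpow_const continuousOn_id fun t ht ↦ Or.inl (ne_of_gt (show (0 : ℝ) < t by linarith [ht.1]))
  rw [← intervalIntegral.integral_add_adjacent_intervals (hg_int 2 Y le_rfl hY2) (hg_int Y X hY2 hYX)]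
  -- first piece: `≤ (1/log 2) ∫_2^Y t^{-1/2} = (2/log 2)(√Y − √2) ≤ (2/log 2) √Y`
  have hlog2 : 0 < Real.log 2 := Real.log_pos (by norm_num)
  have hlog2' : (0.69 : ℝ) < Real.log 2 := by linarith [Real.log_two_gt_d9]
  have h1 : ∫ t in (2 : ℝ)..Y, t ^ (-(1 / 2) : ℝ) / Real.log t ≤ (2 / Real.log 2) * Real.sqrt Y := by
    calc ∫ t in (2 : ℝ)..Y, t ^ (-(1 / 2) : ℝ) / Real.log t
        ≤ ∫ t in (2 : ℝ)..Y, (1 / Real.log 2) * t ^ (-(1 / 2) : ℝ) := by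
          refine intervalIntegral.integral_mono_on hY2 (hg_int 2 Y le_rfl hY2)
            ((hpow_int 2 Y (by norm_num) hY2).const_mul _) fun t ht ↦ ?_
          have ht0 : 0 < t := by linarith [ht.1]
          have hpos : 0 ≤ t ^ (-(1 / 2) : ℝ) := Real.rpow_nonneg ht0.le _
          have hlt : (Real.log t)⁻¹ ≤ (Real.log 2)⁻¹ := inv_anti₀ hlog2 (Real.log_le_log (by norm_num) ht.1)
          calc t ^ (-(1 / 2) : ℝ) / Real.log t = t ^ (-(1 / 2) : ℝ) * (Real.log t)⁻¹ := div_eq_mul_inv _ _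
            _ ≤ t ^ (-(1 / 2) : ℝ) * (Real.log 2)⁻¹ := mul_le_mul_of_nonneg_left hlt hpos
            _ = 1 / Real.log 2 * t ^ (-(1 / 2) : ℝ) := by ring
      _ = (1 / Real.log 2) * (2 * (Real.sqrt Y - Real.sqrt 2)) := by
          rw [intervalIntegral.integral_const_mul, integral_rpow_neg_half 2 Y]
      _ = (2 / Real.log 2) * Real.sqrt Y - (2 / Real.log 2) * Real.sqrt 2 := by ring
      _ ≤ (2 / Real.log 2) * Real.sqrt Y := by
          have h' : 0 ≤ 2 / Real.log 2 * Real.sqrt 2 := by positivity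
          linarith
  -- `√Y ≤ √2 · √(√X)` and `√(√X) log X ≤ 4 √X`
  have hsY : Real.sqrt Y * Real.log X ≤ Real.sqrt 2 * (4 * Real.sqrt X) := by
    have hY_le : Y ≤ 2 * Real.sqrt X := by
      rw [hY]; refine max_le ?_ ?_
      · have : 1 ≤ Real.sqrt X := by rw [Real.le_sqrt (by norm_num) hX0.le]; linarith
        linarith
      · linarith [Real.sqrt_nonneg X]
    have h4 := sqrt_sqrt_mul_log_le hX1
    calc Real.sqrt Y * Real.log X ≤ Real.sqrt (2 * Real.sqrt X) * Real.log X := by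
          gcongr
      _ = Real.sqrt 2 * (Real.sqrt (Real.sqrt X) * Real.log X) := by
          rw [Real.sqrt_mul (by norm_num)]; ring
      _ ≤ Real.sqrt 2 * (4 * Real.sqrt X) := by gcongr
  -- second piece: `≤ (2/log X) ∫_Y^X t^{-1/2} ≤ (2/log X) · 2 √X`
  have h2 : ∫ t in Y..X, t ^ (-(1 / 2) : ℝ) / Real.log t ≤ (2 / Real.log X) * (2 * Real.sqrt X) := by
    have hY0 : 0 < Y := by linarith
    calc ∫ t in Y..X, t ^ (-(1 / 2) : ℝ) / Real.log t
        ≤ ∫ t in Y..X, (2 / Real.log X) * t ^ (-(1 / 2) : ℝ) := by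
          refine intervalIntegral.integral_mono_on hYX (hg_int Y X hY2 hYX)
            ((hpow_int Y X hY0 hYX).const_mul _) fun t ht ↦ ?_
          have ht0 : 0 < t := by linarith [ht.1]
          have hpos : 0 ≤ t ^ (-(1 / 2) : ℝ) := Real.rpow_nonneg ht0.le _
          have hsqX : Real.sqrt X ≤ t := le_trans (le_max_right _ _) ht.1
          have hlogt : Real.log X / 2 ≤ Real.log t := by
            rw [← Real.log_sqrt hX0.le]; exact Real.log_le_log hsX hsqX
          have hlogt0 : 0 < Real.log t := by linarith
          have hlt : (Real.log t)⁻¹ ≤ 2 / Real.log X := by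
            have := inv_anti₀ (by positivity : 0 < Real.log X / 2) hlogt
            rwa [inv_div] at this
          calc t ^ (-(1 / 2) : ℝ) / Real.log t = t ^ (-(1 / 2) : ℝ) * (Real.log t)⁻¹ := div_eq_mul_inv _ _
            _ ≤ t ^ (-(1 / 2) : ℝ) * (2 / Real.log X) := mul_le_mul_of_nonneg_left hlt hpos
            _ = 2 / Real.log X * t ^ (-(1 / 2) : ℝ) := by ring
      _ = (2 / Real.log X) * (2 * (Real.sqrt X - Real.sqrt Y)) := by
          rw [intervalIntegral.integral_const_mul, integral_rpow_neg_half Y X]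
      _ = (2 / Real.log X) * (2 * Real.sqrt X) - (2 / Real.log X) * (2 * Real.sqrt Y) := by ring
      _ ≤ (2 / Real.log X) * (2 * Real.sqrt X) := by
          have h' : 0 ≤ 2 / Real.log X * (2 * Real.sqrt Y) := by positivity
          linarith
  have hs2 : Real.sqrt 2 < 1.42 := by
    rw [Real.sqrt_lt' (by norm_num)]; norm_num
  -- combine: (2/log 2)√Y + 4√X/log X ≤ 22 √X/log X
  have hfirst : (2 / Real.log 2) * Real.sqrt Y ≤ 18 * Real.sqrt X / Real.log X := by
    rw [le_div_iff₀ hlogX]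
    calc 2 / Real.log 2 * Real.sqrt Y * Real.log X = 2 / Real.log 2 * (Real.sqrt Y * Real.log X) := by ring
      _ ≤ 2 / Real.log 2 * (Real.sqrt 2 * (4 * Real.sqrt X)) := by gcongr
      _ ≤ 2 / 0.69 * (1.42 * (4 * Real.sqrt X)) := by
          gcongr
      _ ≤ 18 * Real.sqrt X := by nlinarith
  calc (∫ t in (2 : ℝ)..Y, t ^ (-(1 / 2) : ℝ) / Real.log t) + ∫ t in Y..X, t ^ (-(1 / 2) : ℝ) / Real.log t
      ≤ 18 * Real.sqrt X / Real.log X + (2 / Real.log X) * (2 * Real.sqrt X) := by linarith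
    _ = 22 * Real.sqrt X / Real.log X := by field_simp; ring

/-! ## `f(u) = Σ_{n ≤ u} Λ(n)/(√n log n)` -/

/-- The summand `Λ(n)/(√n log n)`: `= 1/√p` at primes, `≤ 1/√n` at prime powers, `0` otherwise;
in particular `0 ≤ Λ(n)/(√n log n) ≤ 1/√n`. [folklore] -/
theorem vonMangoldt_div_sqrt_log_le (n : ℕ) :
    0 ≤ (Λ n : ℝ) / (Real.sqrt n * Real.log n) ∧ (Λ n : ℝ) / (Real.sqrt n * Real.log n) ≤ 1 / Real.sqrt n := by
  rcases Nat.lt_or_ge n 2 with hn | hn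
  · interval_cases n <;> simp
  have hn0 : (0 : ℝ) < n := by exact_mod_cast (by omega : 0 < n)
  have hlog : 0 < Real.log n := Real.log_pos (by exact_mod_cast hn)
  have hsq : 0 < Real.sqrt n := Real.sqrt_pos.2 hn0
  refine ⟨div_nonneg vonMangoldt_nonneg (by positivity), ?_⟩
  rw [div_le_div_iff₀ (by positivity) hsq, one_mul]
  calc (Λ n : ℝ) * Real.sqrt n ≤ Real.log n * Real.sqrt n := by
        gcongr; exact vonMangoldt_le_log
    _ = Real.sqrt n * Real.log n := mul_comm _ _

/-- **`f(u) = Σ_{n ≤ u} Λ(n)/(√n log n) ≤ 60 √u/log u + (7/2)(log log u + 4)`** for `u ≥ 2`.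
[cite: BalazardDeRoton2008, Prop. 18 (proof)] -/
theorem vonMangoldt_div_sqrt_log_sum_le {u : ℝ} (hu : 2 ≤ u) :
    ∑ n ∈ Finset.Ioc 0 ⌊u⌋₊, (Λ n : ℝ) / (Real.sqrt n * Real.log n) ≤
      60 * Real.sqrt u / Real.log u + (7 / 2) * (Real.log (Real.log u) + 4) := by
  classical
  set g : ℕ → ℝ := fun n ↦ (Λ n : ℝ) / (Real.sqrt n * Real.log n) with hg
  -- split: primes / proper prime powers / the rest
  rw [← Finset.sum_filter_add_sum_filter_not (Finset.Ioc 0 ⌊u⌋₊) Nat.Prime]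
  have hprimes : ∑ n ∈ (Finset.Ioc 0 ⌊u⌋₊).filter Nat.Prime, g n =
      ∑ p ∈ (Finset.Ioc 0 ⌊u⌋₊).filter Nat.Prime, (1 / Real.sqrt p : ℝ) := by
    refine Finset.sum_congr rfl fun p hp ↦ ?_
    rw [Finset.mem_filter] at hp
    have hlog : 0 < Real.log p := Real.log_pos (by exact_mod_cast hp.2.one_lt)
    simp only [hg, vonMangoldt_apply_prime hp.2]
    field_simp
  have hrest : ∑ n ∈ (Finset.Ioc 0 ⌊u⌋₊).filter (fun n ↦ ¬ n.Prime), g n ≤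
      ∑ n ∈ (Finset.Ioc 0 ⌊u⌋₊).filter (fun n ↦ IsPrimePow n ∧ ¬ n.Prime), (1 / Real.sqrt n : ℝ) := by
    rw [← Finset.sum_filter_add_sum_filter_not ((Finset.Ioc 0 ⌊u⌋₊).filter (fun n ↦ ¬ n.Prime)) IsPrimePow]
    have hzero : ∑ n ∈ ((Finset.Ioc 0 ⌊u⌋₊).filter (fun n ↦ ¬ n.Prime)).filter (fun n ↦ ¬ IsPrimePow n), g n = 0 := by
      refine Finset.sum_eq_zero fun n hn ↦ ?_
      rw [Finset.mem_filter] at hn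
      simp only [hg, vonMangoldt_eq_zero_iff.2 hn.2, zero_div]
    rw [hzero, add_zero, Finset.filter_filter]
    have hset : (Finset.Ioc 0 ⌊u⌋₊).filter (fun n ↦ ¬ n.Prime ∧ IsPrimePow n) =
        (Finset.Ioc 0 ⌊u⌋₊).filter (fun n ↦ IsPrimePow n ∧ ¬ n.Prime) := by
      ext n; simp only [Finset.mem_filter]; tauto
    rw [hset]
    exact Finset.sum_le_sum fun n _ ↦ (vonMangoldt_div_sqrt_log_le n).2
  have hpp := sum_properPrimePow_inv_sqrt_le hu
  have hmert := sum_inv_prime_real_le hu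
  have hcheb := sum_primes_inv_sqrt_le hu
  show ∑ n ∈ (Finset.Ioc 0 ⌊u⌋₊).filter Nat.Prime, g n + ∑ n ∈ (Finset.Ioc 0 ⌊u⌋₊).filter (fun n ↦ ¬ n.Prime), g n ≤ _
  rw [hprimes]
  nlinarith

/-! ## The logarithmic weighting -/

/-- **`Σ_{n ≤ x} Λ(n)/(√n log n) · log(x/n) ≤ 1320 √x/log x + (7/2)(log log x + 4) log x`** for
`x ≥ 2` (Abel summation: the sum equals `∫_2^x f(u) du/u`). [cite: BalazardDeRoton2008, Prop. 18 (proof)] -/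
theorem vonMangoldt_weighted_sum_le {x : ℝ} (hx : 2 ≤ x) :
    ∑ n ∈ Finset.Icc 0 ⌊x⌋₊, (Λ n : ℝ) / (Real.sqrt n * Real.log n) * Real.log (x / n) ≤
      1320 * Real.sqrt x / Real.log x + (7 / 2) * (Real.log (Real.log x) + 4) * Real.log x := by
  have hx0 : 0 < x := by linarith
  have hlogx : 0 < Real.log x := Real.log_pos (by linarith)
  set c : ℕ → ℝ := fun n ↦ (Λ n : ℝ) / (Real.sqrt n * Real.log n) with hc
  set f : ℝ → ℝ := fun u ↦ Real.log (x / u) with hf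
  have hc0 : c 0 = 0 := by simp [hc]
  have hc1 : c 1 = 0 := by simp [hc]
  have hfd : ∀ t ∈ Set.Icc 2 x, DifferentiableAt ℝ f t := by
    intro t ht
    have ht0 : t ≠ 0 := by linarith [ht.1]
    exact ((differentiableAt_const x).div differentiableAt_id ht0).log (div_ne_zero hx0.ne' ht0)
  have hderiv : ∀ t : ℝ, 0 < t → deriv f t = -t⁻¹ := by
    intro t ht
    have h1 : f =ᶠ[nhds t] fun u ↦ Real.log x - Real.log u := by
      filter_upwards [lt_mem_nhds ht] with u hu
      simp only [hf]
      rw [Real.log_div hx0.ne' hu.ne']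
    rw [h1.deriv_eq]
    exact ((Real.hasDerivAt_log ht.ne').const_sub (Real.log x)).deriv
  have hderiv_cont : ContinuousOn (fun t : ℝ ↦ -t⁻¹) (Set.Icc 2 x) :=
    (continuousOn_inv₀.mono fun t ht ↦ by
      simp only [Set.mem_compl_iff, Set.mem_singleton_iff]; linarith [ht.1]).neg
  have hfi : IntegrableOn (deriv f) (Set.Icc 2 x) :=
    (hderiv_cont.integrableOn_Icc).congr_fun (fun t ht ↦ (hderiv t (by linarith [ht.1])).symm)
      measurableSet_Icc
  have habel := sum_mul_eq_sub_integral_mul₁ c hc0 hc1 x hfd hfi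
  have hfx : f x = 0 := by simp [hf]
  -- our sum is `Σ f(n) c(n)`
  have hLHS : ∑ n ∈ Finset.Icc 0 ⌊x⌋₊, (Λ n : ℝ) / (Real.sqrt n * Real.log n) * Real.log (x / n) =
      ∑ k ∈ Finset.Icc 0 ⌊x⌋₊, f k * c k := Finset.sum_congr rfl fun n _ ↦ by simp only [hf, hc]; ring
  rw [hLHS, habel, hfx, zero_mul, zero_sub]
  -- `−∫ f' C = ∫ C(u)/u ≤ ∫ (60 u^{-1/2}/log u + (7/2)(LL x + 4)/u)`
  have hsumc : ∀ t : ℝ, ∑ k ∈ Finset.Icc 0 ⌊t⌋₊, c k = ∑ k ∈ Finset.Ioc 0 ⌊t⌋₊, c k := by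
    intro t
    rw [← Finset.sum_Ioc_add_eq_sum_Icc (by omega : 0 ≤ ⌊t⌋₊), hc0, add_zero]
  have hC_le : ∀ t ∈ Set.Ioc 2 x, ∑ k ∈ Finset.Icc 0 ⌊t⌋₊, c k ≤
      60 * Real.sqrt t / Real.log t + (7 / 2) * (Real.log (Real.log x) + 4) := by
    intro t ht
    rw [hsumc]
    refine (vonMangoldt_div_sqrt_log_sum_le ht.1.le).trans ?_
    have : Real.log (Real.log t) ≤ Real.log (Real.log x) :=
      Real.log_le_log (Real.log_pos (by linarith [ht.1])) (Real.log_le_log (by linarith [ht.1]) ht.2)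
    linarith
  have hC_nn : ∀ t : ℝ, 0 ≤ ∑ k ∈ Finset.Icc 0 ⌊t⌋₊, c k := fun t ↦
    Finset.sum_nonneg fun n _ ↦ (vonMangoldt_div_sqrt_log_le n).1
  have hI1 : IntegrableOn (fun t ↦ deriv f t * ∑ k ∈ Finset.Icc 0 ⌊t⌋₊, c k) (Set.Ioc 2 x) :=
    (integrableOn_mul_sum_Icc c (by norm_num) hfi).mono_set Set.Ioc_subset_Icc_self
  set B : ℝ := (7 / 2) * (Real.log (Real.log x) + 4) with hB
  have hB0 : 0 ≤ B := by
    have : -1 ≤ Real.log (Real.log x) := by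
      have h1 : Real.log 2 ≤ Real.log x := Real.log_le_log (by norm_num) hx
      have h2 : (0.69 : ℝ) < Real.log 2 := by linarith [Real.log_two_gt_d9]
      have h3 : Real.log (0.69) ≤ Real.log (Real.log x) := Real.log_le_log (by norm_num) (by linarith)
      have h4 : (-1 : ℝ) ≤ Real.log 0.69 := by
        rw [show (-1 : ℝ) = -(1 : ℝ) by ring, ← Real.log_exp 1, ← Real.log_inv]
        refine Real.log_le_log (by positivity) ?_
        have := Real.exp_one_gt_d9
        rw [inv_le_comm₀ (Real.exp_pos 1) (by norm_num)]
        linarith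
      linarith
    rw [hB]; nlinarith
  have hcont2 : ContinuousOn (fun t : ℝ ↦ 60 * (t ^ (-(1 / 2) : ℝ) / Real.log t) + B * t⁻¹) (Set.Icc 2 x) := by
    refine ContinuousOn.add (ContinuousOn.mul continuousOn_const (ContinuousOn.div ?_ ?_ ?_))
      (ContinuousOn.mul continuousOn_const (continuousOn_inv₀.mono fun t ht ↦ by
        simp only [Set.mem_compl_iff, Set.mem_singleton_iff]; linarith [ht.1]))
    · exact ContinuousOn.rpow_const continuousOn_id fun t ht ↦ Or.inl (ne_of_gt (show (0 : ℝ) < t by linarith [ht.1]))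
    · exact Real.continuousOn_log.mono fun t ht ↦ by simp only [Set.mem_compl_iff, Set.mem_singleton_iff]; linarith [ht.1]
    · intro t ht; exact (Real.log_pos (by linarith [ht.1])).ne'
  have hI2 : IntegrableOn (fun t : ℝ ↦ 60 * (t ^ (-(1 / 2) : ℝ) / Real.log t) + B * t⁻¹) (Set.Ioc 2 x) :=
    hcont2.integrableOn_Icc.mono_set Set.Ioc_subset_Icc_self
  have hint_le : -(∫ t in Set.Ioc 2 x, deriv f t * ∑ k ∈ Finset.Icc 0 ⌊t⌋₊, c k) ≤
      ∫ t in Set.Ioc 2 x, (60 * (t ^ (-(1 / 2) : ℝ) / Real.log t) + B * t⁻¹) := by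
    rw [← MeasureTheory.integral_neg]
    refine setIntegral_mono_on hI1.neg hI2 measurableSet_Ioc fun t ht ↦ ?_
    have ht0 : 0 < t := by linarith [ht.1]
    have hlogt : 0 < Real.log t := Real.log_pos (by linarith [ht.1])
    rw [hderiv t ht0]
    have hCt := hC_le t ht
    have hsq : Real.sqrt t * t⁻¹ = t ^ (-(1 / 2) : ℝ) := by
      rw [Real.sqrt_eq_rpow, ← Real.rpow_neg_one, ← Real.rpow_add ht0]; norm_num
    calc -(-t⁻¹ * ∑ k ∈ Finset.Icc 0 ⌊t⌋₊, c k) = t⁻¹ * ∑ k ∈ Finset.Icc 0 ⌊t⌋₊, c k := by ring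
      _ ≤ t⁻¹ * (60 * Real.sqrt t / Real.log t + B) :=
          mul_le_mul_of_nonneg_left hCt (inv_nonneg.2 ht0.le)
      _ = 60 * (t ^ (-(1 / 2) : ℝ) / Real.log t) + B * t⁻¹ := by
          rw [← hsq]; field_simp
  -- evaluate/bound the majorant integral
  have hJ := integral_rpow_neg_half_div_log_le hx
  have hg_int : IntervalIntegrable (fun t : ℝ ↦ t ^ (-(1 / 2) : ℝ) / Real.log t) volume 2 x := by
    refine ContinuousOn.intervalIntegrable ?_
    rw [Set.uIcc_of_le hx]
    refine ContinuousOn.div ?_ ?_ ?_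
    · exact ContinuousOn.rpow_const continuousOn_id fun t ht ↦ Or.inl (ne_of_gt (show (0 : ℝ) < t by linarith [ht.1]))
    · exact Real.continuousOn_log.mono fun t ht ↦ by simp only [Set.mem_compl_iff, Set.mem_singleton_iff]; linarith [ht.1]
    · intro t ht; exact (Real.log_pos (by linarith [ht.1])).ne'
  have hinv_int : IntervalIntegrable (fun t : ℝ ↦ t⁻¹) volume 2 x :=
    intervalIntegral.intervalIntegrable_inv (fun t ht ↦ by
      rw [Set.uIcc_of_le hx] at ht; exact (ne_of_gt (by linarith [ht.1]))) continuousOn_id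
  have hmaj : ∫ t in Set.Ioc 2 x, (60 * (t ^ (-(1 / 2) : ℝ) / Real.log t) + B * t⁻¹) ≤
      1320 * Real.sqrt x / Real.log x + B * Real.log x := by
    rw [← intervalIntegral.integral_of_le hx,
      intervalIntegral.integral_add (hg_int.const_mul 60) (hinv_int.const_mul B),
      intervalIntegral.integral_const_mul, intervalIntegral.integral_const_mul,
      integral_inv_of_pos (by norm_num) hx0]
    have hlog2x : Real.log (x / 2) ≤ Real.log x := by
      refine Real.log_le_log (by positivity) (by linarith)
    have h1 : B * Real.log (x / 2) ≤ B * Real.log x := mul_le_mul_of_nonneg_left hlog2x hB0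
    have h2 : (60 : ℝ) * (∫ t in (2 : ℝ)..x, t ^ (-(1 / 2) : ℝ) / Real.log t) ≤ 60 * (22 * Real.sqrt x / Real.log x) :=
      mul_le_mul_of_nonneg_left hJ (by norm_num)
    calc 60 * (∫ t in (2 : ℝ)..x, t ^ (-(1 / 2) : ℝ) / Real.log t) + B * Real.log (x / 2)
        ≤ 60 * (22 * Real.sqrt x / Real.log x) + B * Real.log x := add_le_add h2 h1
      _ = 1320 * Real.sqrt x / Real.log x + B * Real.log x := by ring
  have := hint_le.trans hmaj
  rw [hB] at this
  linarith

end ChebyshevWeighted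

export ChebyshevWeighted (vonMangoldt_div_sqrt_log_sum_le vonMangoldt_weighted_sum_le)

end Literature.NumberTheory.LFunctions
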